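import Summits.ABC.IUTFork.LanaEtaLimThetaInf
import Literature.IUT.HodgeArakelov.EtaleThetaDataOfSetting
import Literature.IUT.HodgeArakelov.EtaleThetaDataOfSettingConjStable
import Literature.IUT.HodgeArakelov.TemperedThetaMonoids
import HarnessLib

/-!
# L-LANA dictionary: LANA's Fig. 3 Steps 2–3 (`θ(Π_v)`, `∞θ(Π_v)`, `M^Θ_{v,∞}`) ARE [IUTchII] Prop. 1.4's `∞θ(Π)`
# (layer L6, `EtaleThetaData.thetaInfty`) and an instance of [IUTchII] Prop. 3.1's `ThetaEnvData` (layer L6)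

Record-only MERGE-MAP file (D-0012; seat abc-iut-c312-4 gen 7, L-LANA level, plan/LLANA-SPEC N14 Steps 2–3 ↔ the
corpus layer L6's typings of [IUTchII] Prop. 1.4 / Prop. 3.1; cf. plan/L6/MERGE-MAP.md). TAKES NO SIDE on
[IUTchIII] Cor. 3.12. LANA §6.2 (d) p. 34: "IUT II defines a direct-limit enlargement `∞θ(Π_v) ⊆ lim_J H¹(Π_{v,Ÿ}|_J,
(l·Δ_Θ)(Π_v))` consisting of elements of the direct limit of the cohomologies for which some positive multiple
coincides up to torsion with an element of `θ(Π_v)` [11, Prop. 1.4, p. 238]. We then write `M^Θ_{v,∞} := O^×_v(Π_v) ·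
∞θ(Π_v)`"; and (ibid.) "(Here we are intentionally sloppy. In the strict formulation, one distinguishes the
Frobenioid-theoretic theta monoid `M^{Θ,Frob}_{v,∞}`, which appears on the left side of Figure 3, from its
Kummer-theoretic image …)". [cite: LANA2026Report, §6.2 (d) p. 34] Layer L6 types the SAME objects from [IUTchII]
directly: abc-iut-L6-t1's `EtaleThetaData.thetaInfty` (`MonoThetaFromGroups.lean`: Prop. 1.4 p. 27 "the subset of
elements of the direct limit of cohomology modules … for which some [positive integer] multiple coincides, up to
torsion, with an element of `θ(Π)`") and abc-iut-L6-t2's `ThetaEnvData` / `inftyThetaMonoid = M^×_TM · ∞θ^ι_env^ℕ`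
(`TemperedThetaMonoids.lean`, Prop. 3.1 (i) p. 87). [cite: Mochizuki2012, Prop 1.4 p.27]

PROVED / CONSTRUCTED (gen 5's record `S : EtaLimSide φ A' H A` of `LanaEtaLim.lean`, p424629):
§1 `thetaInfSet_eq_image_of_thetaClasses_eq` — if `θ(Π_v)` is (the multiplicative copy of) a set `Θ` of classes,
   LANA's `∞θ` (gen 5 `thetaInfSet`, multiplicative) IS `{x | ∃ n > 0, ∃ t ∈ Θ, n•x − t torsion}` (additive); hence
   AT LAYER L6's MODEL (`etaleThetaDataOfSetting`, abc-iut-L6: genuine `Π^tp_X̲̲`, real cohomology system, `θ(Π)`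
   from the root classes): **`thetaInfSet_eq_image_thetaInfty` — LANA's `∞θ(Π_v)` = [IUTchII] Prop. 1.4's
   `∞θ(Π)`** when `S.thetaClasses` is the image in the limit of L6's `θ(Π)`.
§2 `EtaLimSide.toThetaEnvData` — the étale side of Fig. 3 READ AS abc-iut-L6-t2's [IUTchII] Prop. 3.1 data over
   the genuine limit: `H := ∞H¹(Π_{v,Ÿ}, A')` with the conjugation action (abc-iut-w4-d043/w4-d007
   `h1LimConjMulAut`), `M^×_TM := κ(O^×)`, `M_TM := κ(O^▷)` (`units_eq` PROVED from `κ` injective and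
   `O^× = (O^▷)^×`), one inversion index (LANA suppresses `ι`), `θ_env := θ(Π_v)`, `∞θ_env := ∞θ(Π_v)`;
   **`toThetaEnvData_inftyThetaMonoid` — L6's `∞Ψ_env = M^×_TM · ∞θ_env^ℕ` IS LANA's `M^Θ_{v,∞}`** (gen 0
   `thetaMonoidEt`, by `rfl`); `toThetaEnvData_constantMonoid_map_res` — restricting `Ψ_cns = κ(O^▷)` to `D_t` gives
   LANA's `κ_t(O^▷_{v,t})` (abc-iut-w4-d007 `map_h1LimRestrict_map_h1LimKummer`); `…_isConjStable` — `Ψ_cns`,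
   `M^×_TM` are conjugation-stable for `Π`-stable `O^▷`, `O^×`; `conj_permutes_of_stable` — Prop. 3.1 (i)'s
   "natural conjugation action" clause for the one-index family, GIVEN `θ(Π_v)` conjugation-stable.
HONEST SCOPE: a DICTIONARY — no statement of [IUTchII] is asserted; Prop. 3.1 (i)'s "splitting up to torsion"
(`Prop31Statements.splitting`: theta classes meet the units only in torsion) is NOT provable at this generality
(it is [EtTh] content about the genuine theta class) and is not claimed. NOT here: any judgement.
v2 (APPEND-ONLY, §3; earlier declarations byte-identical): the same dictionary at abc-iut-L6's model OF RECORD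
`etaleThetaDataOfSetting'` (one-root orbit, `S.l = l`): `thetaInfSet_eq_image_thetaInfty'`, and
**`conj_permutes_model'`** — Prop. 3.1 (i)'s conjugation clause for `toThetaEnvData` HOLDS there with NO stability
hypothesis on `θ(Π_v)`: it is abc-iut-w4-d030's `image_h1LimConjEquiv_toLim_theta` (`θ(Π)` of the model is stable
under the conjugation action of `Π^tp_X̲̲`), consumed BY NAME.
-/

noncomputable section

namespace Summit.ABC
namespace IUTFork

open Literature.AnabelianGeometry.EtaleTheta
open Literature.IUT.HodgeArakelov
open Literature.IUT.HodgeArakelov.CohomologySystemOfContH1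

namespace EtaLimSide

variable {P : TopGroup.{0}} {G' : Type} [Group G'] [TopologicalSpace G'] [IsTopologicalGroup G']
  {φ : P →* G'} {A' : Subgroup G'} [A'.Normal] [IsMulCommutative A'] {H : Subgroup P}
  {A : Type} [CommGroup A] [MulDistribMulAction P A] [TopologicalSpace A] [RootableBy A ℕ]
  (S : EtaLimSide φ A' H A)

/-! ## 1. LANA's `∞θ` is [IUTchII] Prop. 1.4's `∞θ` -/

/-- **Multiplicative ↔ additive.** If `θ(Π_v)` is the multiplicative copy of a set `Θ` of classes of the (additively
written) limit, then LANA's `∞θ(Π_v) = {x | xⁿ/θ₀ torsion}` is the multiplicative copy of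
`{x | ∃ n > 0, ∃ t ∈ Θ, n•x − t torsion}` — [IUTchII] Prop. 1.4's wording "some [positive integer] multiple
coincides, up to torsion, with an element of `θ(Π)`" ("the module structure [i.e., which is usually denoted
additively!]"). [cite: LANA2026Report, §6.2 (d) p. 34] [cite: Mochizuki2012, Prop 1.4 p.27] -/
theorem thetaInfSet_eq_image_of_thetaClasses_eq (Θ : Set (h1Lim φ A' H ⊥))
    (hθ : S.thetaClasses = Multiplicative.ofAdd '' Θ) :
    S.thetaInfSet = Multiplicative.ofAdd '' {x | ∃ n : ℕ, 0 < n ∧ ∃ t ∈ Θ, IsOfFinAddOrder (n • x - t)} := by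
  ext x
  constructor
  · rintro ⟨n, hn, t, ht, hfin⟩
    rw [hθ] at ht
    obtain ⟨t₀, ht₀, rfl⟩ := ht
    refine ⟨Multiplicative.toAdd x, ⟨n, hn, t₀, ht₀, ?_⟩, rfl⟩
    rw [← isOfFinOrder_ofAdd_iff, ofAdd_sub, ofAdd_nsmul, ofAdd_toAdd]
    exact hfin
  · rintro ⟨y, ⟨n, hn, t₀, ht₀, hfin⟩, rfl⟩
    refine ⟨n, hn, Multiplicative.ofAdd t₀, hθ ▸ ⟨t₀, ht₀, rfl⟩, ?_⟩
    rw [← ofAdd_nsmul, ← ofAdd_sub]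
    exact isOfFinOrder_ofAdd_iff.mpr hfin

end EtaLimSide

section Model

open Literature.IUT.HodgeArakelov.EtaleThetaDataOfSetting

variable {p : ℕ} [Fact p.Prime] {D : Literature.AnabelianGeometry.EtaleTheta.ThetaSetting p}
  {E : D.EtaleThetaData} {l : ℕ} (C : E.DoubleUnderline l) (hC : D.Compat) (hS : D.Sec2Hyps)
  (hchar : PiYddCharacteristic C) (Sset : Literature.IUT.HodgeArakelov.ThetaSetting.{0})
  (eS : (Pi C) ≃ₜ* Sset.PiX)
  {A : Type} [CommGroup A] [MulDistribMulAction (Pi C) A] [TopologicalSpace A] [RootableBy A ℕ]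

/-- **LANA's `∞θ(Π_v)` = [IUTchII] Prop. 1.4's `∞θ(Π)` at layer L6's model.** For a Fig. 3 record over L6's genuine
`Π := Π^tp_X̲̲`, `Π_{v,Ÿ} := Π^tp_Ÿ̲̲`, `A' := l·Δ_Θ` whose `θ(Π_v)` is the image in the limit (L6 `toLim ⊤`) of the
`θ(Π)` of abc-iut-L6's bridge `etaleThetaDataOfSetting` (the `μ_l`-multiples of the reciprocals of the root
classes, (6-1)), gen 5's `thetaInfSet` IS abc-iut-L6-t1's `EtaleThetaData.thetaInfty` (read multiplicatively).
[cite: LANA2026Report, §6.2 (d) p. 34] [cite: Mochizuki2012, Prop 1.4 p.27] -/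
theorem EtaLimSide.thetaInfSet_eq_image_thetaInfty (S : EtaLimSide (phi C) (D.lDeltaTheta l) (PiYdd C) A)
    (hθ : S.thetaClasses = Multiplicative.ofAdd ''
      ((coh C).toLim ⊤ '' (etaleThetaDataOfSetting C hC hS hchar Sset eS).theta)) :
    S.thetaInfSet = Multiplicative.ofAdd '' (etaleThetaDataOfSetting C hC hS hchar Sset eS).thetaInfty := by
  rw [S.thetaInfSet_eq_image_of_thetaClasses_eq _ hθ]
  congr 1
  ext x
  constructor
  · rintro ⟨n, hn, t, ⟨t₀, ht₀, rfl⟩, hfin⟩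
    exact ⟨n, hn, t₀, ht₀, hfin⟩
  · rintro ⟨n, hn, t₀, ht₀, hfin⟩
    exact ⟨n, hn, _, ⟨t₀, ht₀, rfl⟩, hfin⟩

end Model

/-! ## 2. The étale side of Fig. 3 as [IUTchII] Prop. 3.1 data (`ThetaEnvData`, layer L6) -/

namespace EtaLimSide

open Literature.IUT.HodgeArakelov.TemperedThetaMonoids

variable {P : TopGroup.{0}} {G' : Type} [Group G'] [TopologicalSpace G'] [IsTopologicalGroup G']
  {φ : P →* G'} {A' : Subgroup G'} [A'.Normal] [IsMulCommutative A'] {H : Subgroup P} [H.Normal]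
  {A : Type} [CommGroup A] [MulDistribMulAction P A] [TopologicalSpace A] [RootableBy A ℕ]
  (S : EtaLimSide φ A' H A) (hinj : Function.Injective S.kappaH)
  (hunits : ∀ a : A, a ∈ S.O → a⁻¹ ∈ S.O → a ∈ S.units)

/-- **LANA's Fig. 3 étale side as abc-iut-L6-t2's `ThetaEnvData`** ([IUTchII] Prop. 3.1 p. 87 data) over the
genuine limit: ambient `H := ∞H¹(Π_{v,Ÿ}, A')` (multiplicative) with the conjugation action of `Π`
(`h1LimConjMulAut`, `Π_{v,Ÿ}` normal), `M^×_TM := κ_H(O^×)`, `M_TM := κ_H(O^▷)`, ONE inversion index (LANA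
suppresses the `ι`'s of Prop. 2.2 (i)), `θ_env := θ(Π_v)`, `∞θ_env := ∞θ(Π_v)`. The field `units_eq`
(`M^×_TM` = the units of `M_TM`) is PROVED from `κ_H` injective (`hinj`) and `O^× = {a ∈ O^▷ | a⁻¹ ∈ O^▷}` (`hunits`;
`O^× ⊆ O^▷` is the record's `units_le`). [cite: LANA2026Report, §6.2 (d) p. 34] [cite: Mochizuki2012, Prop 3.1 p.87] -/
def toThetaEnvData : TemperedThetaMonoids.ThetaEnvData.{0, 0} P where
  H := CommGrpCat.of (Multiplicative (h1Lim φ A' H ⊥))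
  conj := h1LimConjMulAut φ A' H
  Iota := PUnit
  units := S.units.map S.kappaH
  constants := S.O.map S.kappaH
  units_eq x := by
    constructor
    · rintro ⟨u, hu, rfl⟩
      exact ⟨⟨u, S.units_le hu, rfl⟩, ⟨u⁻¹, S.units_le (Subgroup.inv_mem S.units hu), by rw [map_inv]⟩⟩
    · rintro ⟨⟨o, ho, hox⟩, ⟨o', ho', hox'⟩⟩
      have ho'' : o' = o⁻¹ := hinj (by rw [map_inv, hox, hox'])
      exact ⟨o, hunits o ho (ho'' ▸ ho'), hox⟩
  thetaEnv _ := S.thetaClasses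
  inftyThetaEnv _ := S.thetaInfSet
  theta_subset _ := S.thetaClasses_subset_thetaInfSet

/-- **L6's `∞Ψ^ι_env = M^×_TM · ∞θ^ι_env^ℕ` IS LANA's `M^Θ_{v,∞} = O^×(Π_v)·⟨∞θ(Π_v)⟩`** (gen 0 `thetaMonoidEt`), on
the nose. [cite: LANA2026Report, §6.2 (d) p. 34] [cite: Mochizuki2012, Prop 3.1 (i) p.87] -/
theorem toThetaEnvData_inftyThetaMonoid (ι : PUnit) :
    (S.toThetaEnvData hinj hunits).inftyThetaMonoid ι = S.toEtaSteps.thetaMonoidEt := rfl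

/-- L6's `Ψ^ι_env = M^×_TM · θ^ι_env^ℕ` is `O^×(Π_v)·⟨θ(Π_v)⟩ ≤ M^Θ_{v,∞}`. [cite: Mochizuki2012, Prop 3.1 (i) p.87] -/
theorem toThetaEnvData_thetaMonoid (ι : PUnit) :
    (S.toThetaEnvData hinj hunits).thetaMonoid ι = S.toEtaSteps.unitsEt ⊔ Submonoid.closure S.thetaClasses := rfl

/-- … in particular `Ψ_env ≤ ∞Ψ_env = M^Θ_{v,∞}`. [cite: Mochizuki2012, Prop 3.1 (i) p.87] -/
theorem toThetaEnvData_thetaMonoid_le (ι : PUnit) :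
    (S.toThetaEnvData hinj hunits).thetaMonoid ι ≤ S.toEtaSteps.thetaMonoidEt :=
  (S.toThetaEnvData hinj hunits).thetaMonoid_le_infty ι

/-- L6's `Ψ_cns = M_TM` is the `Π_{v,Ÿ}`-level Kummer image `κ_H(O^▷)`. [cite: Mochizuki2012, Prop 3.1 (ii) p.88] -/
theorem toThetaEnvData_constantMonoid : (S.toThetaEnvData hinj hunits).constantMonoid = S.O.map S.kappaH := rfl

/-- **Restricting `Ψ_cns = κ_H(O^▷)` to `D_t` gives LANA's `κ_t(O^▷_{v,t})`** (Fig. 3, Step 6 target; abc-iut-w4-d007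
`map_h1LimRestrict_map_h1LimKummer` + `mrange_h1LimKummerOn`). [cite: LANA2026Report, §6.2 (g) p. 35]
[cite: Mochizuki2012, Cor 1.12 p.56] -/
theorem toThetaEnvData_constantMonoid_map_res (t : S.T) :
    ((S.toThetaEnvData hinj hunits).constantMonoid).map (S.toEtaSteps.res t) =
      MonoidHom.mrange (S.toEtaSteps.kappa t) := by
  rw [toThetaEnvData_constantMonoid]
  change (S.O.map (h1LimKummer φ A' H S.c S.hA S.hfi)).map
      (AddMonoidHom.toMultiplicative (h1LimRestrict φ A' (S.D_le t) ⊥)) =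
    MonoidHom.mrange (h1LimKummerOn φ A' (S.D t) S.c S.hA S.hfi S.O)
  rw [map_h1LimRestrict_map_h1LimKummer, mrange_h1LimKummerOn]

/-- `Ψ_cns = κ_H(O^▷)` is stable under the conjugation action when `O^▷` is `Π`-stable ("equipped with a natural
conjugation action by `Π_X(M^Θ_*)`"; abc-iut-w4-d007 `map_h1LimKummer_stable`). [cite: Mochizuki2012, Prop 3.1 (ii) p.88] -/
theorem toThetaEnvData_constantMonoid_isConjStable (hO : ∀ (g : P) (a : A), a ∈ S.O → g • a ∈ S.O) :
    (S.toThetaEnvData hinj hunits).IsConjStable (S.toThetaEnvData hinj hunits).constantMonoid :=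
  fun g x hx => map_h1LimKummer_stable φ A' H S.c S.hA S.hfi S.O hO g x hx

/-- `M^×_TM = κ_H(O^×)` is stable under the conjugation action when `O^×` is `Π`-stable.
[cite: Mochizuki2012, Prop 3.1 (ii) p.88] -/
theorem toThetaEnvData_units_isConjStable (hU : ∀ (g : P) (a : A), a ∈ S.units → g • a ∈ S.units) :
    (S.toThetaEnvData hinj hunits).IsConjStable (S.toThetaEnvData hinj hunits).units.toSubmonoid :=
  fun g x hx => map_h1LimKummer_stable φ A' H S.c S.hA S.hfi S.units.toSubmonoid hU g x hx

/-- **Prop. 3.1 (i)'s "natural conjugation action" clause for the one-index family**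
(`Prop31Statements.conj_permutes` shape): each `g ∈ Π` carries `Ψ_env = O^×(Π_v)·⟨θ(Π_v)⟩` onto itself, GIVEN
that `O^×` is `Π`-stable and `θ(Π_v)` is stable under the conjugation action (at L6's model: `θ(Π)` is built from
the whole `Π^tp_X̲̲`-orbit of the root class). [cite: Mochizuki2012, Prop 3.1 (i) p.87] -/
theorem conj_permutes_of_stable (hU : ∀ (g : P) (a : A), a ∈ S.units → g • a ∈ S.units)
    (hθ : ∀ g : P, (h1LimConjMulAut φ A' H g) '' S.thetaClasses = S.thetaClasses) (g : P) (ι : PUnit) :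
    ∃ ι' : PUnit, ((S.toThetaEnvData hinj hunits).thetaMonoid ι).map
      ((S.toThetaEnvData hinj hunits).conj g).toMonoidHom = (S.toThetaEnvData hinj hunits).thetaMonoid ι' := by
  refine ⟨ι, ?_⟩
  change (splitMonoid (S.units.map S.kappaH) (Submonoid.closure S.thetaClasses)).map
      (h1LimConjMulAut φ A' H g).toMonoidHom =
    splitMonoid (S.units.map S.kappaH) (Submonoid.closure S.thetaClasses)
  rw [splitMonoid, Submonoid.map_sup, MonoidHom.map_mclosure]
  congr 1
  · -- units part: `g·κ(O^×) = κ(g·O^×) = κ(O^×)`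
    ext x
    constructor
    · rintro ⟨y, hy, rfl⟩
      exact map_h1LimKummer_stable φ A' H S.c S.hA S.hfi S.units.toSubmonoid hU g y hy
    · intro hx
      refine ⟨(h1LimConjMulAut φ A' H g)⁻¹ x, ?_, by simp⟩
      have := map_h1LimKummer_stable φ A' H S.c S.hA S.hfi S.units.toSubmonoid hU g⁻¹ x hx
      rwa [map_inv] at this
  · -- theta part
    change Submonoid.closure ((h1LimConjMulAut φ A' H g) '' S.thetaClasses) = _
    rw [hθ g]

end EtaLimSide

/-! ## 3. (v2) At abc-iut-L6's model of record `etaleThetaDataOfSetting'` -/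

section ModelPrime

open Literature.IUT.HodgeArakelov.EtaleThetaDataOfSetting Literature.IUT.HodgeArakelov.TemperedThetaMonoids

variable {p : ℕ} [Fact p.Prime] {D : Literature.AnabelianGeometry.EtaleTheta.ThetaSetting p}
  {E : D.EtaleThetaData} {l : ℕ} (C : E.DoubleUnderline l) (hC : D.Compat) (hS : D.Sec2Hyps)
  (hchar : PiYddCharacteristic C) (Sset : Literature.IUT.HodgeArakelov.ThetaSetting.{0})
  (eS : (Pi C) ≃ₜ* Sset.PiX) (hl : Sset.l = l)
  {A : Type} [CommGroup A] [MulDistribMulAction (Pi C) A] [TopologicalSpace A] [RootableBy A ℕ]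

/-- **LANA's `∞θ(Π_v)` = [IUTchII] Prop. 1.4's `∞θ(Π)` at L6's model of record** `etaleThetaDataOfSetting'` (one-root
orbit, `S.l = l`), for a record whose `θ(Π_v)` is the image in the limit of that model's `θ(Π)`.
[cite: LANA2026Report, §6.2 (d) p. 34] [cite: Mochizuki2012, Prop 1.4 p.27] -/
theorem EtaLimSide.thetaInfSet_eq_image_thetaInfty' (S : EtaLimSide (phi C) (D.lDeltaTheta l) (PiYdd C) A)
    (hθ : S.thetaClasses = Multiplicative.ofAdd ''
      ((coh C).toLim ⊤ '' (etaleThetaDataOfSetting' C hC hS hchar Sset eS hl).theta)) :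
    S.thetaInfSet = Multiplicative.ofAdd '' (etaleThetaDataOfSetting' C hC hS hchar Sset eS hl).thetaInfty := by
  rw [S.thetaInfSet_eq_image_of_thetaClasses_eq _ hθ]
  congr 1
  ext x
  constructor
  · rintro ⟨n, hn, t, ⟨t₀, ht₀, rfl⟩, hfin⟩
    exact ⟨n, hn, t₀, ht₀, hfin⟩
  · rintro ⟨n, hn, t₀, ht₀, hfin⟩
    exact ⟨n, hn, _, ⟨t₀, ht₀, rfl⟩, hfin⟩

/-- At L6's model of record the record's `θ(Π_v)` (image in the limit of the model's `θ(Π)`) IS STABLE under the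
conjugation action `h1LimConjMulAut` of `Π^tp_X̲̲` — abc-iut-w4-d030's `image_h1LimConjEquiv_toLim_theta`, read
multiplicatively. [cite: Mochizuki2012, Prop 1.4 p.27] -/
theorem EtaLimSide.image_conj_thetaClasses_model' [(PiYdd C).Normal]
    (S : EtaLimSide (phi C) (D.lDeltaTheta l) (PiYdd C) A)
    (hθ : S.thetaClasses = Multiplicative.ofAdd ''
      ((coh C).toLim ⊤ '' (etaleThetaDataOfSetting' C hC hS hchar Sset eS hl).theta)) (g : Pi C) :
    (h1LimConjMulAut (phi C) (D.lDeltaTheta l) (PiYdd C) g) '' S.thetaClasses = S.thetaClasses := by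
  have key := image_h1LimConjEquiv_toLim_theta C hC hS hchar Sset eS hl g
  -- multiplicative reading of an additive image: `σ·(ofAdd '' T) = ofAdd '' (σ·T)` (pointwise `rfl`)
  have hT : ∀ T : Set (coh C).lim,
      (h1LimConjMulAut (phi C) (D.lDeltaTheta l) (PiYdd C) g) '' (Multiplicative.ofAdd '' T) =
        Multiplicative.ofAdd '' (h1LimConjEquiv (phi C) (D.lDeltaTheta l) (PiYdd C) g '' T) := by
    intro T
    ext y
    constructor
    · rintro ⟨_, ⟨x, hx, rfl⟩, rfl⟩
      exact ⟨_, ⟨x, hx, rfl⟩, rfl⟩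
    · rintro ⟨_, ⟨x, hx, rfl⟩, rfl⟩
      exact ⟨_, ⟨x, hx, rfl⟩, rfl⟩
  rw [hθ]
  exact (hT _).trans (congrArg (fun T => (Multiplicative.ofAdd '' T : Set (Multiplicative (coh C).lim))) key)

/-- **[IUTchII] Prop. 3.1 (i)'s "natural conjugation action" clause HOLDS for LANA's Fig. 3 read as `ThetaEnvData`
at L6's model of record** — each `g ∈ Π^tp_X̲̲` carries `Ψ_env = O^×(Π_v)·⟨θ(Π_v)⟩` onto itself — with NO hypothesis
on `θ(Π_v)` (its stability is w4-d030's theorem); remaining inputs: `κ_H` injective (w4-d007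
`h1LimKummer_injective_of_coeff` for bijective `c`), `O^× = (O^▷)^×`, `O^×` stable under `Π` (true for `{|·| = 1}`:
the action is Galois, isometric). [cite: Mochizuki2012, Prop 3.1 (i) p.87] [cite: LANA2026Report, §6.2 (d) p. 34] -/
theorem EtaLimSide.conj_permutes_model' [(PiYdd C).Normal]
    (S : EtaLimSide (phi C) (D.lDeltaTheta l) (PiYdd C) A) (hinj : Function.Injective S.kappaH)
    (hunits : ∀ a : A, a ∈ S.O → a⁻¹ ∈ S.O → a ∈ S.units)
    (hU : ∀ (g : Pi C) (a : A), a ∈ S.units → g • a ∈ S.units)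
    (hθ : S.thetaClasses = Multiplicative.ofAdd ''
      ((coh C).toLim ⊤ '' (etaleThetaDataOfSetting' C hC hS hchar Sset eS hl).theta)) (g : Pi C) (ι : PUnit) :
    ∃ ι' : PUnit, ((S.toThetaEnvData hinj hunits).thetaMonoid ι).map
      ((S.toThetaEnvData hinj hunits).conj g).toMonoidHom = (S.toThetaEnvData hinj hunits).thetaMonoid ι' :=
  S.conj_permutes_of_stable hinj hunits hU (S.image_conj_thetaClasses_model' C hC hS hchar Sset eS hl hθ) g ι

end ModelPrime

end IUTFork

end Summit.ABC

end
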